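import Literature.NumberTheory.DiophantineGeometry.PastenSubexpDecomposition
import HarnessLib

/-!
# Pasten's subexponential abc bounds, II: the approximation theorem applied to `u/v`

Topic `NumberTheory/DiophantineGeometry`; namespace `Literature.NumberTheory.DiophantineGeometry.Pasten`.
Sibling proof file of `PastenSubexpDecomposition.lean` (D-0014); no new definitions.

H. Pasten, *The largest prime factor of `n² + 1` and improvements on subexponential `ABC`*,
Invent. Math. 236 (2024), §4 [cite: Pasten2024, §4]: with `ξ = u/v` split as
`ξ = ξ₀ · ∏_{p ∈ I} p^{e_p}` (`I` = primes with `|e_p| > N`, `ξ₀` = cofactor; file I), the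
group `Γ = ⟨ξ₀, p (p ∈ I)⟩ ∋ ξ` has `m = #I + 1` generators of heights `h(ξ₀)` and
`h(p) = log p`, so item (i) of the approximation theorem (Pasten's Theorem 2.1 with `d = 1`,
`Literature.NumberTheory.DiophantineGeometry.Dioph.PastenApproximationBound K`, itself deduced in
`MultiplicativeGroupApproximation.lean` from Evertse–Győry's Theorem 4.2.1 over `ℚ`) gives
`−log |1 − u/v| < K^m · log max{e, h(u/v)} · h(ξ₀) · ∏_{p ∈ I} log p`.

The printed argument silently needs `ξ₀ ≠ 1` (a torsion generator has height `0` and would make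
the right-hand side vanish); when `ξ₀ = 1` one simply generates by the primes of `I` alone
(`m = #I ≥ 1`, as `u/v ≠ 1`). Both cases are covered by the single quantity
`Θ = theta K u v N = K^{#I+1} · max(1, h(ξ₀)) · ∏_{p ∈ I} log p` of file I once `K ≥ 1`:
the main result here is `neg_log_abs_one_sub_div_le`,
`−log |1 − u/v| ≤ Θ · log max{e, h(u/v)}` for coprime positive `u, v` with `uv > 1`.

## References

* [Pasten2024] H. Pasten, Invent. Math. 236 (2024), 373–385, doi:10.1007/s00222-024-01244-6,
  arXiv:2312.03566 — Theorem 2.1 (i) and §4 (proof of Theorem 1.4 (1)).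
* [EvertseGyory2015] J.-H. Evertse, K. Győry, *Unit Equations in Diophantine Number Theory*,
  CUP 2015 — Theorem 4.2.1 (p. 68).
-/

noncomputable section

open Finset Real Height Literature.NumberTheory.DiophantineGeometry.Dioph

namespace Literature.NumberTheory.DiophantineGeometry.Pasten

variable {u v : ℕ}

/-! ### Small facts about the generators -/

/-- A prime, cast to `ℚ`, is a non-torsion non-zero rational (`≠ 0, 1, −1`). [folklore] -/
theorem natCast_prime_nonTorsion {p : ℕ} (hp : p.Prime) :
    (p : ℚ) ≠ 0 ∧ (p : ℚ) ≠ 1 ∧ (p : ℚ) ≠ -1 := by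
  refine ⟨by exact_mod_cast hp.ne_zero, by exact_mod_cast hp.ne_one, fun h => ?_⟩
  have h0 : (0 : ℚ) ≤ p := Nat.cast_nonneg p
  rw [h] at h0
  norm_num at h0

/-- `h(p) = log p` for a prime `p` (height of a positive integer). [folklore] -/
theorem logHeight₁_natCast_prime {p : ℕ} (hp : p.Prime) : logHeight₁ (p : ℚ) = Real.log p := by
  haveI : NeZero p := ⟨hp.ne_zero⟩
  exact Rat.logHeight₁_natCast p

/-- For coprime positive `u, v` with `uv > 1`, `u/v ≠ 1`. [folklore] -/
theorem cast_div_ne_one (hv : v ≠ 0) (huv : u.Coprime v) (h1 : 1 < u * v) :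
    (u : ℚ) / v ≠ 1 := by
  intro h
  have hv' : (v : ℚ) ≠ 0 := by exact_mod_cast hv
  rw [div_eq_one_iff_eq hv'] at h
  have huv' : u = v := by exact_mod_cast h
  subst huv'
  have hu1 : u = 1 := by simpa using huv
  subst hu1
  simp at h1

/-- If the cofactor is trivial, some prime of `uv` is big (for `uv > 1`). [folklore] -/
theorem bigPrimes_nonempty_of_cofactor_eq_one (hu : u ≠ 0) (hv : v ≠ 0) (huv : u.Coprime v)
    {N : ℕ} (h1 : 1 < u * v) (h : cofactor u v N = 1) : (bigPrimes u v N).Nonempty := by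
  rw [Finset.nonempty_iff_ne_empty]
  intro hT
  exact cofactor_ne_one hu hv huv hT h1 h

/-- `log max{e, t} ≥ 1`, in particular it is positive. [folklore] -/
theorem one_le_log_max_exp_one (t : ℝ) : 1 ≤ Real.log (max (Real.exp 1) t) := by
  rw [← Real.log_exp 1]
  exact Real.log_le_log (Real.exp_pos 1) (by rw [Real.log_exp]; exact le_max_left _ _)

/-! ### Item (i) of the approximation theorem, with the product named -/

/-- Item (i) of `PastenApproximationBound K` with sign `ζ = 1`, restated for an element `x`
*equal* to the product of powers of the generators:
`−log |1 − x| < K^m · log max{e, h(x)} · ∏ h(ξᵢ)`. [cite: Pasten2024, Theorem 2.1 (i)] -/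
theorem neg_log_abs_lt_of_prod_eq {K : ℝ} (hK : PastenApproximationBound K) (ι : Type)
    [Fintype ι] (hι : 0 < Fintype.card ι) (ξ : ι → ℚ)
    (hξ : ∀ i, ξ i ≠ 0 ∧ ξ i ≠ 1 ∧ ξ i ≠ -1) (b : ι → ℤ) {x : ℚ}
    (hx : ∏ i, ξ i ^ b i = x) (hx1 : x ≠ 1) :
    -Real.log |((1 - x : ℚ) : ℝ)| <
      K ^ Fintype.card ι * Real.log (max (Real.exp 1) (logHeight₁ x)) *
        ∏ i, logHeight₁ (ξ i) := by
  have hne : (1 : ℚ) * ∏ i, ξ i ^ b i ≠ 1 := by rwa [one_mul, hx]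
  have h := (hK ι hι ξ hξ 1 (Or.inl rfl) b hne).1
  simp only [one_mul] at h
  rwa [hx] at h

/-! ### The bound for `u/v` in terms of `Θ` -/

/-- **The approximation theorem applied to the splitting of `u/v`** (Pasten, §4, display before
(4.1), with the case `ξ₀ = 1` repaired): for `K ≥ 1` with `PastenApproximationBound K`, coprime
positive `u, v` with `uv > 1` and any threshold `N`,
`−log |1 − u/v| ≤ Θ · log max{e, h(u/v)}`, `Θ = theta K u v N`. [cite: Pasten2024, §4] -/
theorem neg_log_abs_one_sub_div_le {K : ℝ} (hK : PastenApproximationBound K) (hK1 : 1 ≤ K)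
    (hu : u ≠ 0) (hv : v ≠ 0) (huv : u.Coprime v) (h1 : 1 < u * v) (N : ℕ) :
    -Real.log |1 - (u : ℝ) / v| ≤
      theta K u v N * Real.log (max (Real.exp 1) (logHeight₁ ((u : ℚ) / v))) := by
  set I := bigPrimes u v N with hI
  set ξ₀ := cofactor u v N with hξ₀
  set x : ℚ := (u : ℚ) / v with hxdef
  have hsplit : x = ξ₀ * ∏ p ∈ I, (p : ℚ) ^ expDiff u v p :=
    cast_div_eq_cofactor_mul_prod hu hv huv N
  have hx1 : x ≠ 1 := cast_div_ne_one hv huv h1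
  have hcast : ((1 - x : ℚ) : ℝ) = 1 - (u : ℝ) / v := by
    rw [hxdef]; push_cast; ring
  have hLpos : 0 < Real.log (max (Real.exp 1) (logHeight₁ x)) :=
    lt_of_lt_of_le one_pos (one_le_log_max_exp_one _)
  have hP0 : 0 ≤ ∏ p ∈ I, Real.log p := prod_log_bigPrimes_nonneg u v N
  have hK0 : 0 ≤ K := le_trans zero_le_one hK1
  have hprime : ∀ i : ↥I, ((i : ℕ) : ℚ) ≠ 0 ∧ ((i : ℕ) : ℚ) ≠ 1 ∧ ((i : ℕ) : ℚ) ≠ -1 :=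
    fun i => natCast_prime_nonTorsion (prime_of_mem_bigPrimes i.2)
  have hlogI : ∏ i : ↥I, logHeight₁ ((i : ℕ) : ℚ) = ∏ p ∈ I, Real.log p := by
    rw [← Finset.prod_coe_sort I]
    exact Finset.prod_congr rfl fun i _ =>
      logHeight₁_natCast_prime (prime_of_mem_bigPrimes i.2)
  have hpowI : ∏ i : ↥I, ((i : ℕ) : ℚ) ^ expDiff u v i = ∏ p ∈ I, (p : ℚ) ^ expDiff u v p :=
    Finset.prod_coe_sort I (fun p => (p : ℚ) ^ expDiff u v p)
  rw [← hcast, theta_def, ← hI, ← hξ₀]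
  by_cases h0 : ξ₀ = 1
  · -- generate by the big primes alone
    have hne : I.Nonempty := bigPrimes_nonempty_of_cofactor_eq_one hu hv huv h1 (hξ₀ ▸ h0)
    have hcard : 0 < Fintype.card ↥I := by rw [Fintype.card_coe]; exact hne.card_pos
    have hx : ∏ i : ↥I, ((i : ℕ) : ℚ) ^ expDiff u v i = x := by
      rw [hpowI, hsplit, h0, one_mul]
    have key := neg_log_abs_lt_of_prod_eq hK ↥I hcard (fun i => ((i : ℕ) : ℚ)) hprime
      (fun i => expDiff u v i) hx hx1
    rw [hlogI, Fintype.card_coe] at key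
    refine key.le.trans ?_
    rw [h0, logHeight₁_one, max_eq_left zero_le_one, one_mul]
    calc K ^ #I * Real.log (max (Real.exp 1) (logHeight₁ x)) * ∏ p ∈ I, Real.log p
        = K ^ #I * ((∏ p ∈ I, Real.log p) * Real.log (max (Real.exp 1) (logHeight₁ x))) := by
          ring
      _ ≤ K ^ (#I + 1) * ((∏ p ∈ I, Real.log p) * Real.log (max (Real.exp 1) (logHeight₁ x))) :=
          mul_le_mul_of_nonneg_right (pow_le_pow_right₀ hK1 (Nat.le_succ _))
            (mul_nonneg hP0 hLpos.le)
      _ = K ^ (#I + 1) * (∏ p ∈ I, Real.log p) * Real.log (max (Real.exp 1) (logHeight₁ x)) := by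
          ring
  · -- generate by the cofactor and the big primes
    have hξ₀pos : 0 < ξ₀ := cofactor_pos u v N
    have hgen : ∀ o : Option ↥I,
        (o.elim ξ₀ fun i => ((i : ℕ) : ℚ)) ≠ 0 ∧ (o.elim ξ₀ fun i => ((i : ℕ) : ℚ)) ≠ 1 ∧
          (o.elim ξ₀ fun i => ((i : ℕ) : ℚ)) ≠ -1 := by
      rintro (_ | i)
      · exact ⟨hξ₀pos.ne', h0, by intro h; simp only [Option.elim] at h; linarith⟩
      · exact hprime i
    have hx : ∏ o : Option ↥I,
        (o.elim ξ₀ fun i => ((i : ℕ) : ℚ)) ^ (o.elim (1 : ℤ) fun i => expDiff u v i) = x := by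
      rw [Fintype.prod_option]
      simp only [Option.elim, zpow_one]
      rw [hpowI, hsplit]
    have key := neg_log_abs_lt_of_prod_eq hK (Option ↥I) (by simp)
      (fun o => o.elim ξ₀ fun i => ((i : ℕ) : ℚ)) hgen
      (fun o => o.elim (1 : ℤ) fun i => expDiff u v i) hx hx1
    rw [Fintype.prod_option, Fintype.card_option, Fintype.card_coe] at key
    simp only [Option.elim] at key
    rw [hlogI] at key
    refine key.le.trans ?_
    calc K ^ (#I + 1) * Real.log (max (Real.exp 1) (logHeight₁ x)) *
          (logHeight₁ ξ₀ * ∏ p ∈ I, Real.log p)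
        = K ^ (#I + 1) * (logHeight₁ ξ₀ * ∏ p ∈ I, Real.log p) *
            Real.log (max (Real.exp 1) (logHeight₁ x)) := by ring
      _ ≤ K ^ (#I + 1) * (max 1 (logHeight₁ ξ₀) * ∏ p ∈ I, Real.log p) *
            Real.log (max (Real.exp 1) (logHeight₁ x)) := by
          apply mul_le_mul_of_nonneg_right _ hLpos.le
          apply mul_le_mul_of_nonneg_left _ (pow_nonneg hK0 _)
          exact mul_le_mul_of_nonneg_right (le_max_right _ _) hP0

end Literature.NumberTheory.DiophantineGeometry.Pasten

end
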